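import Summits.QuantumFields.BalabanUV.T4Continuum.Support.NE3LinearisedAverageSup
import Summits.QuantumFields.BalabanUV.T4Continuum.Support.NE3NestedBlockMeanCovariance
import HarnessLib

/-!
# NE7IteratedAverageSegment — BRICK N1 (datum half) OF THE REP♭ ROAD: THE `(i+1)`-FOLD BLOCK AVERAGE OF A SMALL-FIELD CONFIGURATION IS
# WITHIN `Σ_{m ≤ i} L^{i−m}·4·loopRad(radIter m x)` OF THE STRAIGHT CORNER-SEGMENT TRANSPORTER `U(L^{i+1}•y; [·, · + L^{i+1}e_ν])`

Cell `pub-balaban`, sub-cell t4, lineage `b2b-balaban-t4-ne7-p1`, gen 73 (CRUX PROVER NE7 #1).  Memo `t4/b2b-balaban-t4-ne7-p1-g73/REP-FLAT-ROAD-v2.md` §2 (F4)(ii)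
and step 0: the companion of `NE7BlockAxialGauge` (this gen).  There, in the block-rooted axial gauge every face link equals the CORNER-SEGMENT transporter of its
face up to `O(M²ε)`; here the corner segments are tied to the DATA: at every level `i+1` the iterated T4 average `cavgIter L (i+1) U (y, ν)` (B7 (42) iterated,
`AveragingDeficitMultiLevelPrep.cavgIter`) differs from the straight transporter of `U` along `[L^{i+1}•y, L^{i+1}•y + L^{i+1}e_ν]` by at most
`Σ_{m=0}^{i} L^{i−m}·4·loopRad(d, L, radIter m x)` — ONE level is row NE3's `NE3NestedBlockMeanCovariance.norm_cavg_sub_bseg_le` (`‖V̄(c) − U(Γ_c)‖ ≤ 4·loopRad`),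
the levels telescope along the segment through unitarity (§1), and the radii climb the tower by `NE3LinearisedAverageSup.levelData` ∕ `NE3TangentCovariantTower.step_small`.
CONSEQUENCE (for the successor's assembly, not restated here): with the top datum `cavgIter L (k+1) U^{u} = flat` the top corner segments are within that sum of `1`,
so with `NE7BlockAxialGauge` EVERY link of `U^{u_ax}` is `O(δ)` (`ε = δ∕M²`), and at level `j` the datum `cavgIter L j U^{u_ax}` is `O(δ)`-close to `1` — the
intrinsic `β₀` of the memo's induction L(j).
WHAT ([folklore]; 0 def, 0 sorry): §1 `hol_seg_add` (segments concatenate), `norm_mul_sub_mul_le'`, **`norm_hol_seg_sub_hol_seg_le`** (a coarse segment of `N` links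
each within `b` of the corresponding fine `L`-segment is within `N·b` of the fine `LN`-segment); §2 **`norm_cavgIter_sub_seg_le`** (the letter, induction on the level
with the configuration generalised); §3 `norm_cavgIter_sub_seg_le_top` (the same at the top level `i = k`, corner `M•y`, `M = L^{k+1}`, in the shape
`NE7BlockAxialGauge.exists_blockAxialGauge` (iii) consumes).
HONEST FRAMING (page 1): bookkeeping over row NE3's one-level letter; [B7] (42) p. 23 ∕ Prop. 1 p. 24 are TEXT LOCATIONS, nothing printed is asserted; no gauge
fixing here; REP♭ NOT proved; (APE) at the trivial flat datum conditional on it; NOT NE7; spine 0∕9; finite T⁴ rung (B)+1 — NOT infinite volume, NOT mass gap, NOT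
BetaPertH, NOT Clay.  Continuum YM on T⁴ ⇐ BetaPertH ∧ nine spine estimates (0/9 proved); BetaPertH ⇐ (D1) ∧ (D4) ∧ CAP+tail; G-an2-4 gates asym, D1 and NE2/3/4.
-/

set_option autoImplicit false

open scoped BigOperators Matrix Matrix.Norms.L2Operator
open Finset

namespace Summit.QuantumFields.BalabanUV.T4Continuum.NE7IteratedAverageSegment

open Literature.MathematicalPhysics.QuantumFieldTheory.Balaban1983to89
open B7Prop1Explicit B7Prop2Explicit
open T4AveragingDeficitWall (IsUnitaryCfg SmallField)
open AveragingDeficitTransport (mem_U1_of_unitary)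
open AveragingDeficitChartCalculus (cavg)
open AveragingDeficitTwoLevelPrep (prop1Radius)
open AveragingDeficitMultiLevelPrep (cavgIter LevelSmall radIter)
open AveragingDeficitBlockDensity (bseg)
open NE3TangentCovariantTower (step_small cavgIter_succ)
open NE3NestedBlockMeanCovariance (norm_cavg_sub_bseg_le)
open SpreadLift (loopRad)

noncomputable section

variable {d : ℕ} {n : Type} [Fintype n] [DecidableEq n] [Nonempty n]

/-! ## §1 Segments concatenate; a coarse segment against the fine segment it covers -/

omit [Fintype n] [DecidableEq n] [Nonempty n] in
/-- `U(p; [p, p + (a+b)e_κ]) = U(p; [p, p + ae_κ])·U(p + ae_κ; [·, · + be_κ])`. [folklore] -/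
theorem hol_seg_add {G : Type*} [Group G] (V : Site d → Fin d → G) (p : Site d) (κ : Fin d) (a b : ℕ) :
    hol V p (seg κ ((a + b : ℕ) : ℤ)) = hol V p (seg κ (a : ℤ)) * hol V (p + (a : ℤ) • e κ) (seg κ (b : ℤ)) := by
  rw [seg_natCast, seg_natCast, seg_natCast, List.replicate_add, hol_append, disp_replicate]
  simp [Letter.vec]

omit [Fintype n] [DecidableEq n] [Nonempty n] in
/-- `‖ab − a′b′‖ ≤ ‖a − a′‖ + ‖b − b′‖` when `‖b‖ ≤ 1`, `‖a′‖ ≤ 1`. [folklore] -/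
theorem norm_mul_sub_mul_le' {𝔸 : Type*} [NormedRing 𝔸] {a a' b b' : 𝔸} (hb : ‖b‖ ≤ 1) (ha' : ‖a'‖ ≤ 1) :
    ‖a * b - a' * b'‖ ≤ ‖a - a'‖ + ‖b - b'‖ := by
  have h : a * b - a' * b' = (a - a') * b + a' * (b - b') := by noncomm_ring
  rw [h]
  calc _ ≤ ‖(a - a') * b‖ + ‖a' * (b - b')‖ := norm_add_le _ _
    _ ≤ ‖a - a'‖ * ‖b‖ + ‖a'‖ * ‖b - b'‖ := add_le_add (norm_mul_le _ _) (norm_mul_le _ _)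
    _ ≤ ‖a - a'‖ * 1 + 1 * ‖b - b'‖ :=
        add_le_add (mul_le_mul_of_nonneg_left hb (norm_nonneg _)) (mul_le_mul_of_nonneg_right ha' (norm_nonneg _))
    _ = _ := by ring

/-- **A COARSE SEGMENT AGAINST THE FINE SEGMENT IT COVERS**: if every coarse link `W′(z + te_ν, ν)` is within `b` of the fine `L`-segment transporter
`W(L•(z + te_ν); [·, · + Le_ν])`, then `‖W′(z; [z, z + Ne_ν]) − W(L•z; [L•z, L•z + LNe_ν])‖ ≤ N·b` (unitary `W`, `W′`). [folklore] -/
theorem norm_hol_seg_sub_hol_seg_le {W' W : Site d → Fin d → (Matrix n n ℂ)ˣ} (hW' : IsUnitaryCfg W') (hW : IsUnitaryCfg W) (L : ℕ)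
    (z : Site d) (ν : Fin d) {b : ℝ}
    (h : ∀ t : ℕ, ‖((W' (z + (t : ℤ) • e ν) ν : (Matrix n n ℂ)ˣ) : Matrix n n ℂ)
        - ((hol W ((L : ℤ) • (z + (t : ℤ) • e ν)) (seg ν (L : ℤ)) : (Matrix n n ℂ)ˣ) : Matrix n n ℂ)‖ ≤ b) :
    ∀ N : ℕ, ‖((hol W' z (seg ν (N : ℤ)) : (Matrix n n ℂ)ˣ) : Matrix n n ℂ)
        - ((hol W ((L : ℤ) • z) (seg ν ((L * N : ℕ) : ℤ)) : (Matrix n n ℂ)ˣ) : Matrix n n ℂ)‖ ≤ (N : ℝ) * b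
  | 0 => by simp
  | N + 1 => by
      have ih := norm_hol_seg_sub_hol_seg_le hW' hW L z ν h N
      have hU1W : ∀ x κ, W x κ ∈ U1 (Matrix n n ℂ) := fun x κ => mem_U1_of_unitary (hW x κ)
      have hU1W' : ∀ x κ, W' x κ ∈ U1 (Matrix n n ℂ) := fun x κ => mem_U1_of_unitary (hW' x κ)
      have e1 : hol W' z (seg ν ((N + 1 : ℕ) : ℤ)) = hol W' z (seg ν (N : ℤ)) * W' (z + (N : ℤ) • e ν) ν := by
        rw [Nat.cast_succ, hol_seg_natCast_succ]
      have e2 : hol W ((L : ℤ) • z) (seg ν ((L * (N + 1) : ℕ) : ℤ))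
          = hol W ((L : ℤ) • z) (seg ν ((L * N : ℕ) : ℤ)) * hol W ((L : ℤ) • (z + (N : ℤ) • e ν)) (seg ν (L : ℤ)) := by
        rw [show L * (N + 1) = L * N + L by ring, hol_seg_add,
          show (L : ℤ) • z + ((L * N : ℕ) : ℤ) • e ν = (L : ℤ) • (z + (N : ℤ) • e ν) by rw [smul_add, smul_smul]; push_cast; rfl]
      rw [e1, e2, Units.val_mul, Units.val_mul]
      calc _ ≤ ‖((hol W' z (seg ν (N : ℤ)) : (Matrix n n ℂ)ˣ) : Matrix n n ℂ) - ((hol W ((L : ℤ) • z) (seg ν ((L * N : ℕ) : ℤ)) : (Matrix n n ℂ)ˣ) : Matrix n n ℂ)‖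
            + ‖((W' (z + (N : ℤ) • e ν) ν : (Matrix n n ℂ)ˣ) : Matrix n n ℂ)
              - ((hol W ((L : ℤ) • (z + (N : ℤ) • e ν)) (seg ν (L : ℤ)) : (Matrix n n ℂ)ˣ) : Matrix n n ℂ)‖ :=
            norm_mul_sub_mul_le' (mem_U1.mp (hU1W' _ _)).1 (mem_U1.mp (hol_mem hU1W _ _)).1
        _ ≤ (N : ℝ) * b + b := add_le_add ih (h N)
        _ = ((N + 1 : ℕ) : ℝ) * b := by push_cast; ring

/-! ## §2 THE LETTER: iterated average against the corner segment, every level -/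

/-- **THE `(i+1)`-FOLD AVERAGE AGAINST THE CORNER SEGMENT** (dimension `d`, `L ≥ 1`): for unitary `W` with plaquette radius `x ≥ 0` in the multi-level class
`LevelSmall d L i x`, every coarse site `y` and direction `ν`:
`‖cavgIter L (i+1) W (y, ν) − W(L^{i+1}•y; [·, · + L^{i+1}e_ν])‖ ≤ Σ_{m=0}^{i} L^{i−m}·4·loopRad(d, L, radIter d L m x)`.
Induction on `i` with `W` generalised: `cavgIter L (i+2) W = cavgIter L (i+1) (cavg L W)`; row NE3's one-level letter for `cavg L W` against `bseg`; §1 along the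
`L^{i+1}` coarse links; `Finset.sum_range_succ'`. [folklore] -/
theorem norm_cavgIter_sub_seg_le {L : ℕ} (hL : 1 ≤ L) (i : ℕ) :
    ∀ {W : Site d → Fin d → (Matrix n n ℂ)ˣ} {x : ℝ}, IsUnitaryCfg W → 0 ≤ x → LevelSmall d L i x → SmallField W x →
      ∀ (y : Site d) (ν : Fin d),
        ‖((cavgIter L (i + 1) W y ν : (Matrix n n ℂ)ˣ) : Matrix n n ℂ)
            - ((hol W (((L ^ (i + 1) : ℕ) : ℤ) • y) (seg ν ((L ^ (i + 1) : ℕ) : ℤ)) : (Matrix n n ℂ)ˣ) : Matrix n n ℂ)‖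
          ≤ ∑ m ∈ Finset.range (i + 1), (L : ℝ) ^ (i - m) * (4 * loopRad d L (radIter d L m x)) := by
  induction i with
  | zero =>
      intro W x hW hx hs hWx y ν
      obtain ⟨h512, -, -, -⟩ := step_small hL hW hx hs hWx
      have h1 := norm_cavg_sub_bseg_le hL hW hx h512 hWx y ν
      rw [Finset.sum_range_one, pow_zero, one_mul, zero_add, pow_one, cavgIter_succ]
      change ‖((cavg L W y ν : (Matrix n n ℂ)ˣ) : Matrix n n ℂ) - ((hol W ((L : ℤ) • y) (seg ν (L : ℤ)) : (Matrix n n ℂ)ˣ) : Matrix n n ℂ)‖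
        ≤ 4 * loopRad d L x
      exact h1
  | succ i ih =>
      intro W x hW hx hs hWx y ν
      obtain ⟨h512, hW', hx', hW'x⟩ := step_small hL hW hx hs.1 hWx
      have hi := ih hW' hx' hs.2 hW'x y ν
      -- the coarse `L^{i+1}`-segment of `cavg L W` against the fine `L^{i+2}`-segment of `W`
      have hlink : ∀ t : ℕ, ‖((cavg L W ((((L ^ (i + 1) : ℕ) : ℤ) • y) + (t : ℤ) • e ν) ν : (Matrix n n ℂ)ˣ) : Matrix n n ℂ)
          - ((hol W ((L : ℤ) • (((((L ^ (i + 1) : ℕ) : ℤ) • y) + (t : ℤ) • e ν))) (seg ν (L : ℤ)) : (Matrix n n ℂ)ˣ) : Matrix n n ℂ)‖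
            ≤ 4 * loopRad d L x :=
        fun t => norm_cavg_sub_bseg_le hL hW hx h512 hWx _ ν
      have hseg := norm_hol_seg_sub_hol_seg_le hW' hW L ((((L ^ (i + 1) : ℕ) : ℤ) • y)) ν hlink (L ^ (i + 1))
      have hcorner : (L : ℤ) • ((((L ^ (i + 1) : ℕ) : ℤ)) • y) = (((L ^ (i + 1 + 1) : ℕ) : ℤ)) • y := by
        rw [smul_smul]; congr 1; push_cast; ring
      have hlen : L * L ^ (i + 1) = L ^ (i + 1 + 1) := by ring
      rw [hcorner, hlen] at hseg
      rw [cavgIter_succ]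
      calc _ ≤ ‖((cavgIter L (i + 1) (cavg L W) y ν : (Matrix n n ℂ)ˣ) : Matrix n n ℂ)
              - ((hol (cavg L W) (((L ^ (i + 1) : ℕ) : ℤ) • y) (seg ν ((L ^ (i + 1) : ℕ) : ℤ)) : (Matrix n n ℂ)ˣ) : Matrix n n ℂ)‖
            + ‖((hol (cavg L W) (((L ^ (i + 1) : ℕ) : ℤ) • y) (seg ν ((L ^ (i + 1) : ℕ) : ℤ)) : (Matrix n n ℂ)ˣ) : Matrix n n ℂ)
              - ((hol W (((L ^ (i + 1 + 1) : ℕ) : ℤ) • y) (seg ν ((L ^ (i + 1 + 1) : ℕ) : ℤ)) : (Matrix n n ℂ)ˣ) : Matrix n n ℂ)‖ := by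
            rw [← sub_add_sub_cancel]; exact norm_add_le _ _
        _ ≤ (∑ m ∈ Finset.range (i + 1), (L : ℝ) ^ (i - m) * (4 * loopRad d L (radIter d L m (prop1Radius d L x))))
            + ((L ^ (i + 1) : ℕ) : ℝ) * (4 * loopRad d L x) := add_le_add hi hseg
        _ = ∑ m ∈ Finset.range (i + 1 + 1), (L : ℝ) ^ (i + 1 - m) * (4 * loopRad d L (radIter d L m x)) := by
            rw [Finset.sum_range_succ' (fun m => (L : ℝ) ^ (i + 1 - m) * (4 * loopRad d L (radIter d L m x)))]
            have hterm : ∀ m : ℕ, (L : ℝ) ^ (i + 1 - (m + 1)) * (4 * loopRad d L (radIter d L (m + 1) x))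
                = (L : ℝ) ^ (i - m) * (4 * loopRad d L (radIter d L m (prop1Radius d L x))) := fun m => by
              rw [Nat.succ_sub_succ_eq_sub]; rfl
            simp only [hterm, Nat.sub_zero, Nat.cast_pow]
            rfl

/-! ## §3 The top level, in the shape the block axial gauge consumes -/

/-- **THE TOP DATUM CONTROLS THE TOP CORNER SEGMENTS**: with `M = L^{k+1}`, for unitary `W` with plaquette radius `x` in the class `LevelSmall d L k x`, every top
corner `M•y` and direction `ν`: `‖W(M•y; [M•y, M•y + Me_ν]) − cavgIter L (k+1) W (y, ν)‖ ≤ Σ_{m=0}^{k} L^{k−m}·4·loopRad(d, L, radIter d L m x)`; in particular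
if `cavgIter L (k+1) W = flat` the corner segments are within that sum of `1`. [folklore] -/
theorem norm_cavgIter_sub_seg_le_top {L : ℕ} (hL : 1 ≤ L) (k : ℕ) {W : Site d → Fin d → (Matrix n n ℂ)ˣ} {x : ℝ} (hW : IsUnitaryCfg W)
    (hx : 0 ≤ x) (hs : LevelSmall d L k x) (hWx : SmallField W x) (y : Site d) (ν : Fin d) :
    ‖((hol W (((L ^ (k + 1) : ℕ) : ℤ) • y) (seg ν ((L ^ (k + 1) : ℕ) : ℤ)) : (Matrix n n ℂ)ˣ) : Matrix n n ℂ)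
        - ((cavgIter L (k + 1) W y ν : (Matrix n n ℂ)ˣ) : Matrix n n ℂ)‖
      ≤ ∑ m ∈ Finset.range (k + 1), (L : ℝ) ^ (k - m) * (4 * loopRad d L (radIter d L m x)) := by
  rw [norm_sub_rev]
  exact norm_cavgIter_sub_seg_le hL k hW hx hs hWx y ν

end

end Summit.QuantumFields.BalabanUV.T4Continuum.NE7IteratedAverageSegment
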